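import Literature.Computability.Complexity.ListFoldBricks
import Literature.Computability.Complexity.FoldBricks
import Literature.Computability.Complexity.IterateFPPoly
import Literature.Computability.Complexity.Promise
import Literature.Computability.Complexity.UniformProbBlocks
import Literature.Computability.Complexity.CountingHierarchyProofs
import Literature.Computability.Complexity.ProbabilisticClassesProofs
import HarnessLib

/-!
# Enumerating the heavy outputs of a randomised polynomial-time function, under `PromiseBPP' ⊆ PromiseP`

Topic `Literature/Computability/Complexity`, toolkit of derandomisation under the hypothesis
`pr-BPP = pr-P` (the inclusion `PromiseBPP' ⊆ PromiseP` of the textbook promise classes of `Promise.lean`).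
Setting: a polynomial-time function `R` run as `R ⟨params, coins⟩` with `C = |cF params|` coins
(`R, cF ∈ FP`), a polynomial-time run count `M = |mF params|` and target length `n = |nF params|`.
A string `x ∈ {0,1}ⁿ` is *heavy* for `params` if one run outputs it with probability `≥ 2/M`. Main result:

* `HeavyEnum.exists_enum_of_PromiseBPP'_subset` — **if `PromiseBPP' ⊆ PromiseP` then some `E ∈ FP` lists,
  on input `params`, every heavy string** (as a coded list, read by `Brick.decNil`).

This is the step "derandomise the randomised reconstruction" behind the enumeration form of Hirahara's
Thm. 3.12 (`MetaComplexity/DPReconstruction.lean`), isolated from the Goldreich–Levin material: there the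
paper fixes the coins by a pseudorandom generator (Lemma 3.4), here only the decision consequence
`pr-BPP = pr-P` of that generator is used.

## The argument (all proved; the construction is folklore)

* The `M`-run test `Hit ⟨params, u⟩ (y) :⇔ ∃ i < M, u ⊑ R ⟨params, block i of y⟩` is a polynomial-time
  one-bit function (`hitFn`, a `Brick.foldLoop` of a disjunction; `hitFn_apply`, `hitFn_mem_FP`), so the
  promise problem "`Pr_y[Hit] ≥ 2/3`" vs "`Pr_y[Hit] ≤ 1/3`" on instances `⟨params, u⟩` is in `PromiseBPP'`
  as it stands (`prefixProblem_mem_PromiseBPP'`; the event depends on the first `M·C` coins,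
  `uniformProb_take_of_le`), hence has a separator `LF ∈ P` under the hypothesis.
* If `x` is heavy, every prefix `u ⊑ x` is hit with probability `≥ 1 - (1 - 2/M)^M ≥ 2/3`
  (`hitProb_ge`: independent blocks `cnt_allBlocks`, `(1-q)^M ≤ e^{-qM} ≤ e^{-2} ≤ 1/3`); a separated
  `u` is hit with probability `> 1/3 `, so by the union bound (`hitProb_le`,
  `uniformProb_exists_badBlock_le`) its one-run prefix frequency exceeds `1/(3M)`; and distinct strings of
  one length have disjoint prefix events, so fewer than `3M` of them are that frequent
  (`length_lt_of_freq_gt`).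
* Hence the prefix search — level `ℓ + 1` = the children `u0, u1` of level `ℓ` accepted by `LF` — keeps
  `x ↾ ℓ` at every level `ℓ ≤ n` and never holds `3M` strings (`frontier_spec`). It is computed by `n`
  rounds (`iterate_mem_FP_of_poly`) of a list fold (`Brick.foldFn`) whose output is clipped to
  `3M(2n+2)` symbols — inactive along the true frontiers, and what makes every round polynomially
  bounded on all inputs (`enumF`, `enumF_mem_FP`, `decNil_enumF`).

## References

* O. Goldreich, *On promise problems: a survey*, LNCS 3895 (2006), §1.2, Def. 1.2 (promise-BPP; the
  hypothesis `promise-BPP = promise-P`).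
* S. Arora, B. Barak, *Computational Complexity: A Modern Approach*, CUP 2009, §7.4.1 (independent
  repetitions), §A.2 (union bound), §1.3–1.4 (polynomial time under composition and bounded loops).
* O. Goldreich, *In a world of P = BPP*, in: Studies in Complexity and Cryptography, LNCS 6650 (2011)
  (search problems under full derandomisation; the prefix search is the standard device).
* S. Hirahara, ECCC TR21-058 (2021), Thm. 3.12 and the remark following it (the consumer).
-/

noncomputable section

namespace Literature.Computability.Complexity

open _root_.Computability Polynomial Finset Brick Plumb HashBricks OracleCompose

namespace HeavyEnum

variable (R cF mF : List Bool → List Bool)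

/-! ### The objects: runs on coin blocks, hits, frequencies -/

/-- The number of coins `C = |cF params|` of one run. [folklore] -/
def Cn (params : List Bool) : ℕ := (cF params).length

/-- The number of runs `M = |mF params|`. [folklore] -/
def Mn (params : List Bool) : ℕ := (mF params).length

/-- The output of one run on `params` with coins `c`: `R ⟨params, c⟩`. [folklore] -/
def out (params c : List Bool) : List Bool := R (boolPair params c)

/-- Coin block `i` (of length `C`) of a coin string `y`. [folklore] -/
def blk (params y : List Bool) (i : ℕ) : List Bool := (y.drop (i * Cn cF params)).take (Cn cF params)

/-- **A hit**: some run `i < M`, on coin block `i`, outputs a string with prefix `u`. [folklore] -/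
def Hit (params u y : List Bool) : Prop := ∃ i < Mn mF params, u <+: out R params (blk cF params y i)

/-- The frequency of the prefix `u`: `Pr_c[u ⊑ R ⟨params, c⟩]`. [folklore] -/
def freq (params u : List Bool) : ℝ := uniformProb (Cn cF params) {c | u <+: out R params c}

/-- The hit probability `Pr_y[Hit]` over `M·C` coins. [folklore] -/
def hitProb (params u : List Bool) : ℝ := uniformProb (Mn mF params * Cn cF params) {y | Hit R cF mF params u y}

variable {R cF mF}

/-- Monotonicity of `uniformProb`. [folklore] -/
private theorem prob_mono {m : ℕ} {E F : Set (List Bool)} (h : ∀ y, y ∈ E → y ∈ F) : uniformProb m E ≤ uniformProb m F := by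
  classical
  unfold uniformProb
  refine div_le_div_of_nonneg_right ?_ (by positivity)
  exact_mod_cast Finset.card_le_card fun r hr => by
    simp only [Finset.mem_filter, Finset.mem_univ, true_and] at hr ⊢
    exact h _ hr

/-- **Union bound**: `Pr[Hit u] ≤ M · freq u`. [Arora–Barak 2009, §A.2] [folklore] -/
theorem hitProb_le (params u : List Bool) : hitProb R cF mF params u ≤ Mn mF params * freq R cF params u := by
  unfold hitProb Hit
  exact uniformProb_exists_badBlock_le le_rfl (fun _ _ => {c | u <+: out R params c}) fun _ _ _ _ => le_rfl

/-- The count of coin strings all of whose `M` blocks miss a set is the `M`-th power of the one-block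
count. [Arora–Barak 2009, §7.4.1 (independent repetitions)] [folklore] -/
theorem cnt_allBlocks (C : ℕ) (G : Set (List Bool)) : ∀ M : ℕ,
    cnt (M * C) {y | ∀ i < M, (y.drop (i * C)).take C ∈ G} = cnt C G ^ M
  | 0 => by
    rw [Nat.zero_mul, pow_zero]
    exact cnt_eq_two_pow_of_forall fun y _ => fun i hi => absurd hi (Nat.not_lt_zero i)
  | M + 1 => by
    have ih := cnt_allBlocks C G M
    rw [show (M + 1) * C = C + M * C by ring, pow_succ, mul_comm (cnt C G ^ M), ← ih, ← cnt_take_drop]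
    refine cnt_congr fun y _ => ?_
    simp only [Set.mem_setOf_eq]
    constructor
    · intro h
      refine ⟨by simpa using h 0 (Nat.succ_pos M), fun i hi => ?_⟩
      have := h (i + 1) (by omega)
      rwa [show (i + 1) * C = C + i * C by ring, ← List.drop_drop] at this
    · rintro ⟨h0, h⟩ i hi
      rcases i with _ | i
      · simpa using h0
      · have := h i (by omega)
        rwa [show (i + 1) * C = C + i * C by ring, ← List.drop_drop]

/-- `(1 - q)^M ≤ 1/3` once `qM ≥ 2` (`1 - q ≤ e^{-q}`, `e^{-2} ≤ 1/3`). [folklore] -/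
theorem one_sub_pow_le_third {q : ℝ} {M : ℕ} (hq1 : q ≤ 1) (h : 2 ≤ M * q) : (1 - q) ^ M ≤ 1 / 3 := by
  have h1 : 1 - q ≤ Real.exp (-q) := by have := Real.add_one_le_exp (-q); linarith
  have h2 : (1 - q) ^ M ≤ Real.exp (-q) ^ M := pow_le_pow_left₀ (by linarith) h1 M
  rw [← Real.exp_nat_mul] at h2
  have h3 : Real.exp (M * -q) ≤ Real.exp (-2) := Real.exp_le_exp.2 (by nlinarith)
  have h4 : Real.exp (-2) ≤ 1 / 3 := by
    rw [Real.exp_neg, inv_eq_one_div, div_le_div_iff_of_pos_left one_pos (Real.exp_pos 2) (by norm_num)]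
    have := Real.add_one_le_exp (2 : ℝ)
    linarith
  linarith

/-- **A heavy output is hit with probability `≥ 2/3`, and so is each of its prefixes.** If one run
outputs `x` with probability `q ≥ 2/M`, then all `M` runs miss `x` with probability `(1 - q)^M ≤ 1/3`.
[Arora–Barak 2009, §7.4.1] [folklore] -/
theorem hitProb_ge {params x u : List Bool} (hx : 2 ≤ Mn mF params * uniformProb (Cn cF params) {c | out R params c = x})
    (hu : u <+: x) : 2 / 3 ≤ hitProb R cF mF params u := by
  set M := Mn mF params with hM
  set C := Cn cF params with hC
  set q := uniformProb C {c | out R params c = x} with hq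
  -- the miss event and its probability
  have hmiss : uniformProb (M * C) {y | ∀ i < M, (y.drop (i * C)).take C ∈ {c | ¬ out R params c = x}} = (1 - q) ^ M := by
    rw [uniformProb_eq_cnt_div, cnt_allBlocks, Nat.cast_pow, mul_comm M C, pow_mul, ← div_pow]
    congr 1
    rw [hq, uniformProb_eq_cnt_div, eq_sub_iff_add_eq, ← add_div, div_eq_one_iff_eq (by positivity)]
    have h := cnt_add_cnt_compl C {c | out R params c = x}
    rw [add_comm] at h
    exact_mod_cast h
  have hq1 : q ≤ 1 := uniformProb_le_one _ _
  have hthird : (1 - q) ^ M ≤ 1 / 3 := one_sub_pow_le_third hq1 hx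
  -- a non-miss is a hit
  have hsub : ∀ y, y ∈ {y | ∀ i < M, (y.drop (i * C)).take C ∈ {c | ¬ out R params c = x}}ᶜ → y ∈ {y | Hit R cF mF params u y} := by
    intro y hy
    simp only [Set.mem_compl_iff, Set.mem_setOf_eq, not_forall, not_not, exists_prop] at hy
    obtain ⟨i, hi, hix⟩ := hy
    exact ⟨i, hi, by rw [blk, ← hC, hix]; exact hu⟩
  have hcompl := uniformProb_compl (M * C) {y | ∀ i < M, (y.drop (i * C)).take C ∈ {c | ¬ out R params c = x}}
  have hle := prob_mono (m := M * C) hsub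
  unfold hitProb
  rw [← hM, ← hC]
  linarith

/-- **Few prefixes of one length are frequent**: distinct strings of a common length have disjoint
prefix events, so their frequencies sum to at most `1`; hence fewer than `3M` of them have frequency
`> 1/(3M)`. [folklore] -/
theorem length_lt_of_freq_gt {params : List Bool} {ℓ : ℕ} {U : List (List Bool)} (hU : U.Nodup)
    (hlen : ∀ u ∈ U, u.length = ℓ) (hfreq : ∀ u ∈ U, 1 / (3 * (Mn mF params : ℝ)) < freq R cF params u)
    (hM : 0 < Mn mF params) : U.length < 3 * Mn mF params := by
  classical
  set C := Cn cF params with hC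
  set M := Mn mF params with hMdef
  -- the prefix events are pairwise disjoint
  have hdisj : (U.toFinset : Set (List Bool)).PairwiseDisjoint fun u =>
      (univ.filter fun r : List.Vector Bool C => u <+: out R params r.toList) := by
    intro u hu u' hu' hne
    rw [Function.onFun, Finset.disjoint_left]
    intro r hr hr'
    simp only [Finset.mem_filter, Finset.mem_univ, true_and] at hr hr'
    simp only [Finset.mem_coe, List.mem_toFinset] at hu hu'
    apply hne
    rw [List.prefix_iff_eq_take] at hr hr'
    rw [hr, hr', hlen u hu, hlen u' hu']
  have hsum : ∑ u ∈ U.toFinset, ((univ.filter fun r : List.Vector Bool C => u <+: out R params r.toList).card : ℝ) ≤ 2 ^ C := by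
    have h := Finset.card_biUnion hdisj
    have hle : (U.toFinset.biUnion fun u => univ.filter fun r : List.Vector Bool C => u <+: out R params r.toList).card ≤ 2 ^ C :=
      (Finset.card_le_univ _).trans (by rw [card_vector, Fintype.card_bool])
    rw [h] at hle
    exact_mod_cast hle
  -- sum of the frequencies
  have hfreq' : ∀ u ∈ U.toFinset, 1 / (3 * (M : ℝ)) < ((univ.filter fun r : List.Vector Bool C => u <+: out R params r.toList).card : ℝ) / 2 ^ C := by
    intro u hu
    have h := hfreq u (List.mem_toFinset.1 hu)
    unfold freq uniformProb at h
    rw [← hC] at h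
    convert h using 4
    ext r; simp
  by_contra hge
  push Not at hge
  have hcardU : U.toFinset.card = U.length := List.toFinset_card_of_nodup hU
  have hM0 : (0 : ℝ) < M := by exact_mod_cast hM
  have h1 : (U.toFinset.card : ℝ) * (1 / (3 * M)) ≤ ∑ u ∈ U.toFinset,
      ((univ.filter fun r : List.Vector Bool C => u <+: out R params r.toList).card : ℝ) / 2 ^ C := by
    rw [← nsmul_eq_mul, ← Finset.sum_const]
    exact Finset.sum_le_sum fun u hu => (hfreq' u hu).le
  have h1' : (U.toFinset.card : ℝ) * (1 / (3 * M)) < ∑ u ∈ U.toFinset,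
      ((univ.filter fun r : List.Vector Bool C => u <+: out R params r.toList).card : ℝ) / 2 ^ C := by
    have hne : U.toFinset.Nonempty := by
      rw [← Finset.card_pos, hcardU]; omega
    rw [← nsmul_eq_mul, ← Finset.sum_const]
    exact Finset.sum_lt_sum_of_nonempty hne fun u hu => hfreq' u hu
  have h2 : ∑ u ∈ U.toFinset, ((univ.filter fun r : List.Vector Bool C => u <+: out R params r.toList).card : ℝ) / 2 ^ C ≤ 1 := by
    rw [← Finset.sum_div, div_le_one (by positivity)]
    exact hsum
  have h3 : (1 : ℝ) ≤ (U.toFinset.card : ℝ) * (1 / (3 * M)) := by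
    rw [hcardU, mul_one_div, le_div_iff₀ (by positivity), one_mul]
    exact_mod_cast hge
  linarith

/-! ### The prefix search (semantic level) -/

section Search

variable (LF : Set (List Bool)) (params : List Bool)

/-- The children of a frontier, in processing order: each `u` followed by `u0`, `u1`. [folklore] -/
def children (front : List (List Bool)) : List (List Bool) := front.flatMap fun u => [u ++ [false], u ++ [true]]

open scoped Classical in
/-- **One level of the prefix search**: the children accepted by the separator `LF` (queried on
`⟨params, child⟩`), latest first (the order in which a left fold conses them). [folklore] -/
def level (front : List (List Bool)) : List (List Bool) :=
  ((children front).filter fun c => boolPair params c ∈ LF).reverse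

/-- **The frontiers of the prefix search** from the empty prefix. [folklore] -/
def frontier : ℕ → List (List Bool)
  | 0 => [[]]
  | ℓ + 1 => level LF params (frontier ℓ)

variable {LF params}

/-- Children of distinct strings of a common length are distinct. [folklore] -/
theorem nodup_children {front : List (List Bool)} (hnd : front.Nodup) : (children front).Nodup := by
  unfold children
  rw [List.nodup_flatMap]
  refine ⟨fun u _ => by simp, ?_⟩
  refine hnd.pairwise_of_forall_ne fun u hu u' hu' hne => ?_
  rw [Function.onFun, List.disjoint_left]
  intro c hc hc'
  simp only [List.mem_cons, List.not_mem_nil, or_false] at hc hc'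
  apply hne
  rcases hc with rfl | rfl <;> rcases hc' with h | h <;> exact List.append_inj_left' h rfl

/-- Children are one symbol longer. [folklore] -/
theorem length_of_mem_children {front : List (List Bool)} {ℓ : ℕ} (hlen : ∀ u ∈ front, u.length = ℓ) {c : List Bool}
    (hc : c ∈ children front) : c.length = ℓ + 1 := by
  simp only [children, List.mem_flatMap, List.mem_cons, List.not_mem_nil, or_false] at hc
  obtain ⟨u, hu, rfl | rfl⟩ := hc <;> simp [hlen u hu]

/-- The next prefix of `x` is a child of the current one. [folklore] -/
theorem take_succ_mem_children {front : List (List Bool)} {x : List Bool} {ℓ : ℕ} (hℓ : ℓ < x.length)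
    (hx : x.take ℓ ∈ front) : x.take (ℓ + 1) ∈ children front := by
  simp only [children, List.mem_flatMap, List.mem_cons, List.not_mem_nil, or_false]
  refine ⟨x.take ℓ, hx, ?_⟩
  rw [List.take_add_one, List.getElem?_eq_getElem hℓ]
  cases x[ℓ] <;> simp

/-- **Correctness of the prefix search.** Let the separator accept `⟨params, u⟩` whenever
`Pr[Hit u] ≥ 2/3` and only if `Pr[Hit u] > 1/3`, and let one run output `x` with probability `≥ 2/M`.
Then for every `ℓ ≤ |x|` the frontier of level `ℓ` consists of fewer than `3M` distinct strings of length
`ℓ` and contains `x ↾ ℓ`: the prefixes of `x` are hit with probability `≥ 2/3` (`hitProb_ge`), an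
accepted string has frequency `> 1/(3M)` (`hitProb_le`), and fewer than `3M` strings of one length do
(`length_lt_of_freq_gt`). [folklore] -/
theorem frontier_spec (hyes : ∀ u, 2 / 3 ≤ hitProb R cF mF params u → boolPair params u ∈ LF)
    (hno : ∀ u, boolPair params u ∈ LF → 1 / 3 < hitProb R cF mF params u) {x : List Bool}
    (hx : 2 ≤ Mn mF params * uniformProb (Cn cF params) {c | out R params c = x}) :
    ∀ ℓ, ℓ ≤ x.length → x.take ℓ ∈ frontier LF params ℓ ∧ (frontier LF params ℓ).Nodup ∧
      (∀ u ∈ frontier LF params ℓ, u.length = ℓ) ∧ (frontier LF params ℓ).length < 3 * Mn mF params := by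
  classical
  have hM : 0 < Mn mF params := by
    rcases Nat.eq_zero_or_pos (Mn mF params) with h | h
    · rw [h, Nat.cast_zero, zero_mul] at hx; norm_num at hx
    · exact h
  intro ℓ
  induction ℓ with
  | zero =>
    intro _
    refine ⟨by simp [frontier], by simp [frontier], by simp [frontier], ?_⟩
    simp only [frontier, List.length_singleton]
    omega
  | succ ℓ ih =>
    intro hℓ
    obtain ⟨hmem, hnd, hlen, -⟩ := ih (by omega)
    have hndc : (children (frontier LF params ℓ)).Nodup := nodup_children hnd
    have hlenc : ∀ c ∈ children (frontier LF params ℓ), c.length = ℓ + 1 := fun c hc => length_of_mem_children hlen hc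
    simp only [frontier, level]
    refine ⟨?_, ?_, ?_, ?_⟩
    · rw [List.mem_reverse, List.mem_filter]
      refine ⟨take_succ_mem_children (by omega) hmem, ?_⟩
      rw [decide_eq_true_eq]
      exact hyes _ (hitProb_ge hx (List.take_prefix _ _))
    · exact List.nodup_reverse.2 (hndc.filter _)
    · intro u hu
      rw [List.mem_reverse, List.mem_filter] at hu
      exact hlenc u hu.1
    · rw [List.length_reverse]
      refine length_lt_of_freq_gt (R := R) (cF := cF) (params := params) (ℓ := ℓ + 1) (hndc.filter _)
        (fun u hu => hlenc u (List.mem_filter.1 hu).1) (fun u hu => ?_) hM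
      have hacc : boolPair params u ∈ LF := by simpa using (List.mem_filter.1 hu).2
      have h1 := hno u hacc
      have h2 := hitProb_le (R := R) (cF := cF) (mF := mF) params u
      have hM' : (0 : ℝ) < Mn mF params := by exact_mod_cast hM
      rw [div_lt_iff₀ (by positivity)]
      nlinarith

end Search

/-! ### The `M`-run hit test is a polynomial-time one-bit function -/

section HitMachine

variable (R cF mF)

/-- `params` from the context `X₀ = ⟨mF params, ⟨⟨params, u⟩, y⟩⟩` (first field of the fold record). [folklore] -/
def prmF : List Bool → List Bool := fstF ∘ fstF ∘ sndF ∘ fstF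
/-- `u` from the context. [folklore] -/
def uF : List Bool → List Bool := sndF ∘ fstF ∘ sndF ∘ fstF
/-- `y` from the context. [folklore] -/
def yF : List Bool → List Bool := sndF ∘ sndF ∘ fstF
/-- `1^C`. [folklore] -/
def cU : List Bool → List Bool := onesFn ∘ cF ∘ prmF
/-- `1^{iC}` from the index `1ⁱ` (second field). [folklore] -/
def offU : List Bool → List Bool := umulFn ∘ fanoutFn sndF (cU cF)
/-- Coin block `i`: `(y ⇂ iC) ↾ C`. [folklore] -/
def blkF : List Bool → List Bool := takeFn ∘ fanoutFn (cU cF) (dropFn ∘ fanoutFn (offU cF) (yF))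
/-- The output of run `i`: `R ⟨params, block i⟩`. [folklore] -/
def outF : List Bool → List Bool := R ∘ fanoutFn (prmF) (blkF cF)
/-- **The piece of the fold**: `[u ⊑ output of run i]` (as `[u = output ↾ |u|]`). [folklore] -/
def pieceF : List Bool → List Bool := eqPairFn ∘ fanoutFn (uF) (takeFn ∘ fanoutFn (uF) (outF R cF))
/-- The disjunction `⟨acc, b⟩ ↦ acc ∨ b` of one-bit strings. [folklore] -/
def orB : List Bool → List Bool := iteFn (headBitFn ∘ fstF) (fun _ => [true]) (headBitFn ∘ sndF)
/-- The initial fold record `⟨X₀, ⟨bin M, ⟨1⁰, [0]⟩⟩⟩` on `w = ⟨⟨params, u⟩, y⟩`, `X₀ = ⟨mF params, w⟩`. [folklore] -/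
def setupF : List Bool → List Bool :=
  fanoutFn (fanoutFn (mF ∘ fstF ∘ fstF) id) (fanoutFn (lenBinF ∘ mF ∘ fstF ∘ fstF) (fanoutFn (fun _ => []) (fun _ => [false])))
/-- **The hit test** `w = ⟨⟨params, u⟩, y⟩ ↦ [∃ i < M, u ⊑ R ⟨params, block i of y⟩]`: a fold of `orB` over
the `M` pieces. [Arora–Barak 2009, §7.4.1 (independent runs)] [folklore] -/
def hitFn : List Bool → List Bool := sndPow 2 ∘ foldLoop orB (pieceF R cF) X ∘ setupF mF

variable {R cF mF}

/-- `eqPairFn` is one-bit. [folklore] -/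
private theorem oneBit_eqPairFn' : OneBit eqPairFn := fun w => by
  rcases eqPairFn_eq_or w with h | h <;> exact ⟨_, h⟩

/-- Value of the piece on `⟨X₀, 1ⁱ⟩`. [folklore] -/
theorem pieceF_apply (params u y : List Bool) (i : ℕ) :
    pieceF R cF (boolPair (boolPair (mF params) (boolPair (boolPair params u) y)) (ones i)) =
      [decide (u <+: out R params (blk cF params y i))] := by
  have hc : cU cF (boolPair (boolPair (mF params) (boolPair (boolPair params u) y)) (ones i)) = ones (Cn cF params) := by
    simp [cU, prmF, onesFn, unaryEncodeNat_eq_replicate, ones, Cn]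
  simp only [pieceF, outF, blkF, offU, uF, yF, prmF, Function.comp_apply, fanoutFn_apply, fstF_boolPair, sndF_boolPair, hc,
    umulFn_boolPair, dropFn_boolPair, takeFn_boolPair, eqPairFn_boolPair]
  simp [ones, out, blk, List.prefix_iff_eq_take]

/-- Value of `orB` on a pair of bits. [folklore] -/
theorem orB_apply (a b : Bool) : orB (boolPair [a] [b]) = [a || b] := by
  unfold orB
  cases a
  · rw [iteFn_apply_false (by simp)]; simp
  · rw [iteFn_apply_true (by simp)]; simp

/-- The fold of the pieces is the disjunction of the hits. [folklore] -/
theorem foldAcc_pieces (params u y : List Bool) : ∀ k : ℕ,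
    foldAcc orB (pieceF R cF) (boolPair (mF params) (boolPair (boolPair params u) y)) 0 k [false] =
      [decide (∃ i < k, u <+: out R params (blk cF params y i))]
  | 0 => by simp
  | k + 1 => by
    rw [foldAcc_succ', foldAcc_pieces params u y k, Nat.zero_add, pieceF_apply, orB_apply]
    congr 1
    rw [Bool.eq_iff_iff]
    simp only [Bool.or_eq_true, decide_eq_true_eq]
    constructor
    · rintro (⟨i, hi, h⟩ | h)
      · exact ⟨i, by omega, h⟩
      · exact ⟨k, by omega, h⟩
    · rintro ⟨i, hi, h⟩
      rcases Nat.lt_succ_iff_lt_or_eq.1 hi with hi | rfl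
      · exact Or.inl ⟨i, hi, h⟩
      · exact Or.inr h

/-- **Value of the hit test.** [folklore] -/
theorem hitFn_apply (params u y : List Bool) :
    hitFn R cF mF (boolPair (boolPair params u) y) = [decide (∃ i < Mn mF params, u <+: out R params (blk cF params y i))] := by
  have hsetup : setupF mF (boolPair (boolPair params u) y) =
      boolPair (boolPair (mF params) (boolPair (boolPair params u) y))
        (boolPair (encodeNat (Mn mF params)) (boolPair (ones 0) [false])) := by
    simp [setupF, Mn, ones]
  have hk : Mn mF params ≤ (X : Polynomial ℕ).eval (boolPair (mF params) (boolPair (boolPair params u) y)).length := by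
    simp only [eval_X, length_boolPair, Mn]; omega
  rw [hitFn, Function.comp_apply, Function.comp_apply, hsetup, foldLoop_apply _ _ hk, foldAcc_pieces]
  simp

/-- The hit test accepts exactly the hits. [folklore] -/
theorem hitFn_eq_true_iff (params u y : List Bool) :
    hitFn R cF mF (boolPair (boolPair params u) y) = [true] ↔ Hit R cF mF params u y := by
  rw [hitFn_apply]; simp [Hit]

/-- `hitFn ∈ FP` for `R, cF, mF ∈ FP`. [folklore] -/
theorem hitFn_mem_FP (hR : R ∈ FP) (hc : cF ∈ FP) (hm : mF ∈ FP) : hitFn R cF mF ∈ FP := by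
  have hprm : prmF ∈ FP := comp_mem_FP fstF_mem_FP (comp_mem_FP fstF_mem_FP (comp_mem_FP sndF_mem_FP fstF_mem_FP))
  have hu : uF ∈ FP := comp_mem_FP sndF_mem_FP (comp_mem_FP fstF_mem_FP (comp_mem_FP sndF_mem_FP fstF_mem_FP))
  have hy : yF ∈ FP := comp_mem_FP sndF_mem_FP (comp_mem_FP sndF_mem_FP fstF_mem_FP)
  have hcU : cU cF ∈ FP := comp_mem_FP onesFn_mem_FP (comp_mem_FP hc hprm)
  have hoff : offU cF ∈ FP := comp_mem_FP umulFn_mem_FP (fanoutFn_mem_FP sndF_mem_FP hcU)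
  have hblk : blkF cF ∈ FP :=
    comp_mem_FP takeFn_mem_FP (fanoutFn_mem_FP hcU (comp_mem_FP dropFn_mem_FP (fanoutFn_mem_FP hoff hy)))
  have hout : outF R cF ∈ FP := comp_mem_FP hR (fanoutFn_mem_FP hprm hblk)
  have hpiece : pieceF R cF ∈ FP :=
    comp_mem_FP eqPairFn_mem_FP (fanoutFn_mem_FP hu (comp_mem_FP takeFn_mem_FP (fanoutFn_mem_FP hu hout)))
  have hor : orB ∈ FP := iteFn_mem_FP (comp_mem_FP headBitFn_mem_FP fstF_mem_FP) (const_mem_FP _)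
    (comp_mem_FP headBitFn_mem_FP sndF_mem_FP)
  have horg : ∀ w, (orB w).length ≤ (fstF w).length + (sndF w).length + 1 := fun w => by
    rw [orB, iteFn_of_oneBit (oneBit_headBitFn.comp _)]
    split_ifs <;> simp
  have hpg : ∀ w, (pieceF R cF w).length ≤ 1 * ((fstF w).length + 1) := fun w => by
    obtain ⟨b, hb⟩ := oneBit_eqPairFn' (fanoutFn uF (takeFn ∘ fanoutFn uF (outF R cF)) w)
    rw [pieceF, Function.comp_apply, hb]; simp
  have hsetup : setupF mF ∈ FP :=
    fanoutFn_mem_FP (fanoutFn_mem_FP (comp_mem_FP hm (comp_mem_FP fstF_mem_FP fstF_mem_FP)) (PolyTimeComputable.id _))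
      (fanoutFn_mem_FP (comp_mem_FP lenBinF_mem_FP (comp_mem_FP hm (comp_mem_FP fstF_mem_FP fstF_mem_FP)))
        (fanoutFn_mem_FP (const_mem_FP _) (const_mem_FP _)))
  exact comp_mem_FP (sndPow_mem_FP 2) (comp_mem_FP (foldLoop_mem_FP hor horg hpiece hpg X) hsetup)

/-- The hit language `{w | hitFn w = [1]}` is in `P`. [folklore] -/
theorem hitLang_mem_P (hR : R ∈ FP) (hc : cF ∈ FP) (hm : mF ∈ FP) :
    ({w | hitFn R cF mF w = [true]} : Language Bool) ∈ Classes.P :=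
  setOf_apply_eq_apply_mem_P (hitFn_mem_FP hR hc hm) (const_mem_FP _)

end HitMachine

/-! ### The promise problem of frequently hit prefixes is in `PromiseBPP'` -/

section PromiseSide

variable (R cF mF)

/-- **The promise problem of frequently hit prefixes**: instances `⟨params, u⟩`; yes iff the `M`-run
hit test hits `u` with probability `≥ 2/3`, no iff with probability `≤ 1/3`. [Goldreich 2006, Def. 1.2
(promise-BPP); Arora–Barak 2009, Def. 7.3] [folklore] -/
def prefixProblem : PromiseProblem :=
  ⟨{v | ∃ params u : List Bool, v = boolPair params u ∧ 2 / 3 ≤ hitProb R cF mF params u},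
   {v | ∃ params u : List Bool, v = boolPair params u ∧ hitProb R cF mF params u ≤ 1 / 3}⟩

variable {R cF mF}

/-- The blocks of the `M` runs lie within the first `M·C` coins. [folklore] -/
theorem blk_take (params y : List Bool) {i : ℕ} (hi : i < Mn mF params) :
    blk cF params (y.take (Mn mF params * Cn cF params)) i = blk cF params y i := by
  unfold blk
  rw [List.drop_take, List.take_take, min_eq_left]
  have h : (i + 1) * Cn cF params ≤ Mn mF params * Cn cF params := Nat.mul_le_mul_right _ hi
  rw [Nat.succ_mul] at h
  omega

/-- The hit event depends on the first `M·C` coins only. [folklore] -/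
theorem hit_take_iff (params u y : List Bool) :
    Hit R cF mF params u (y.take (Mn mF params * Cn cF params)) ↔ Hit R cF mF params u y := by
  unfold Hit
  constructor
  · rintro ⟨i, hi, h⟩; exact ⟨i, hi, by rwa [blk_take params y hi] at h⟩
  · rintro ⟨i, hi, h⟩; exact ⟨i, hi, by rwa [blk_take params y hi]⟩

/-- The acceptance probability of the hit language over `Q ≥ M·C` coins is the hit probability. [folklore] -/
theorem uniformProb_hitLang (params u : List Bool) {Q : ℕ} (hQ : Mn mF params * Cn cF params ≤ Q) :
    uniformProb Q {y | boolPair (boolPair params u) y ∈ ({w | hitFn R cF mF w = [true]} : Language Bool)} =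
      hitProb R cF mF params u := by
  unfold hitProb
  rw [← uniformProb_take_of_le hQ]
  congr 1
  ext y
  change hitFn R cF mF (boolPair (boolPair params u) y) = [true] ↔ _
  simp only [Set.mem_setOf_eq, hitFn_eq_true_iff, hit_take_iff]

/-- **The promise problem of frequently hit prefixes is in `PromiseBPP'`** (witness: the hit language,
coins: `M·C ≤ s_M(|v|)·s_C(|v|)` for the output-length polynomials of `mF, cF`). [Goldreich 2006,
Def. 1.2; Arora–Barak 2009, §7.4.1] [folklore] -/
theorem prefixProblem_mem_PromiseBPP' (hR : R ∈ FP) (hc : cF ∈ FP) (hm : mF ∈ FP) :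
    prefixProblem R cF mF ∈ PromiseBPP' := by
  obtain ⟨sc, hsc⟩ := exists_poly_length_le_of_mem_FP hc
  obtain ⟨sm, hsm⟩ := exists_poly_length_le_of_mem_FP hm
  have hle : ∀ params u : List Bool, Mn mF params * Cn cF params ≤ (sm * sc).eval (boolPair params u).length := by
    intro params u
    rw [eval_mul, Mn, Cn]
    have h1 : params.length ≤ (boolPair params u).length := by rw [length_boolPair]; omega
    exact Nat.mul_le_mul ((hsm params).trans (TM2Iter.eval_mono sm h1)) ((hsc params).trans (TM2Iter.eval_mono sc h1))
  refine ⟨{w | hitFn R cF mF w = [true]}, hitLang_mem_P hR hc hm, sm * sc, ?_, ?_⟩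
  · rintro v ⟨params, u, rfl, hyes⟩
    exact hyes.trans_eq (uniformProb_hitLang (R := R) (cF := cF) (mF := mF) params u (hle params u)).symm
  · rintro v ⟨params, u, rfl, hno⟩
    have h := uniformProb_compl ((sm * sc).eval (boolPair params u).length)
      {y | boolPair (boolPair params u) y ∈ ({w | hitFn R cF mF w = [true]} : Language Bool)}
    rw [uniformProb_hitLang params u (hle params u)] at h
    refine le_trans ?_ (le_of_eq h.symm)
    linarith

/-- Decoding a yes-instance. [folklore] -/
theorem boolPair_mem_prefixProblem_yes {params u : List Bool} (h : 2 / 3 ≤ hitProb R cF mF params u) :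
    boolPair params u ∈ (prefixProblem R cF mF).yes := ⟨params, u, rfl, h⟩

/-- Decoding a no-instance. [folklore] -/
theorem boolPair_mem_prefixProblem_no {params u : List Bool} (h : hitProb R cF mF params u ≤ 1 / 3) :
    boolPair params u ∈ (prefixProblem R cF mF).no := ⟨params, u, rfl, h⟩

/-- **A separator of the promise problem serves the prefix search**: it accepts every `⟨params, u⟩`
with `Pr[Hit u] ≥ 2/3` and only those with `Pr[Hit u] > 1/3`. [folklore] -/
theorem separator_spec {LF : Set (List Bool)} (hyes : (prefixProblem R cF mF).yes ≤ LF) (hno : (prefixProblem R cF mF).no ≤ LFᶜ)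
    (params : List Bool) :
    (∀ u, 2 / 3 ≤ hitProb R cF mF params u → boolPair params u ∈ LF) ∧
      (∀ u, boolPair params u ∈ LF → 1 / 3 < hitProb R cF mF params u) :=
  ⟨fun _ h => hyes (boolPair_mem_prefixProblem_yes h), fun _ h => by
    by_contra hle
    exact hno (boolPair_mem_prefixProblem_no (not_lt.1 hle)) h⟩

end PromiseSide

/-! ### The prefix search is a polynomial-time function -/

section EnumMachine

variable (indF nF mF : List Bool → List Bool)

/-- `params` from the step record `v = ⟨⟨params, FRONT⟩, ⟨a, acc⟩⟩`. [folklore] -/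
def prm2 : List Bool → List Bool := fstF ∘ fstF
/-- The child `a ++ [b]` of the current item. [folklore] -/
def childF (b : Bool) : List Bool → List Bool := concatFn ∘ fanoutFn (nthF 1) (fun _ => [b])
/-- **Try a child**: cons `a ++ [b]` onto the accumulator iff the separator accepts `⟨params, a ++ [b]⟩`. [folklore] -/
def tryF (b : Bool) : List Bool → List Bool :=
  iteFn (indF ∘ fanoutFn prm2 (childF b)) (fanoutFn (childF b) (sndPow 1)) (sndPow 1)
/-- **The step of the level fold**: try `a0`, then `a1`. [folklore] -/
def stepF : List Bool → List Bool := tryF indF true ∘ fanoutFn fstF (fanoutFn (nthF 1) (tryF indF false))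
/-- `1^M`. [folklore] -/
def m1 : List Bool → List Bool := onesFn ∘ mF
/-- `1ⁿ`. [folklore] -/
def n1 : List Bool → List Bool := onesFn ∘ nF
/-- The clip length `1^{3M(2n+2)}` (on `params`). [folklore] -/
def boundU : List Bool → List Bool :=
  umulFn ∘ fanoutFn (concatFn ∘ fanoutFn (m1 mF) (concatFn ∘ fanoutFn (m1 mF) (m1 mF)))
    (List.cons true ∘ List.cons true ∘ concatFn ∘ fanoutFn (n1 nF) (n1 nF))
/-- **One level** on `z = ⟨params, FRONT⟩`: fold the step over the items of `FRONT`, clip. [folklore] -/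
def levelF : List Bool → List Bool := takeFn ∘ fanoutFn (boundU nF mF ∘ fstF) (foldFn (stepF indF) fun _ => [])
/-- The level as a first-field-preserving round on `⟨1ⁿ, ⟨params, FRONT⟩⟩`. [folklore] -/
def roundF : List Bool → List Bool := fanoutFn fstF (fanoutFn (fstF ∘ sndF) (levelF indF nF mF ∘ sndF))
/-- `n` rounds. [folklore] -/
def iterF : List Bool → List Bool := fun z => (roundF indF nF mF)^[(X : Polynomial ℕ).eval (boolUnpair z).1.length] z
/-- The initial record `⟨1ⁿ, ⟨params, enc [ε]⟩⟩`. [folklore] -/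
def initF : List Bool → List Bool := fanoutFn (n1 nF) (fanoutFn id fun _ => encList [[]])
/-- **The enumerator**: `params ↦ ⟨ε, FRONT_n⟩`, a code of the list `ε :: frontier n`. [folklore] -/
def enumF : List Bool → List Bool := fanoutFn (fun _ => []) (sndPow 1 ∘ iterF indF nF mF ∘ initF nF)

variable {indF nF mF} {LF : Set (List Bool)}

open scoped Classical in
/-- The semantic try: cons an accepted child. [folklore] -/
def trySem (LF : Set (List Bool)) (params a : List Bool) (b : Bool) (acc : List Bool) : List Bool :=
  if boolPair params (a ++ [b]) ∈ LF then boolPair (a ++ [b]) acc else acc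

/-- Value of `tryF` on a step record. [folklore] -/
theorem tryF_apply (hind : ∀ v, indF v = [LF.boolIndicator v]) (b : Bool) (params FR a acc : List Bool) :
    tryF indF b (boolPair (boolPair params FR) (boolPair a acc)) = trySem LF params a b acc := by
  classical
  unfold tryF trySem
  have hc : (indF ∘ fanoutFn prm2 (childF b)) (boolPair (boolPair params FR) (boolPair a acc)) =
      [LF.boolIndicator (boolPair params (a ++ [b]))] := by
    simp [prm2, childF, hind]
  by_cases h : boolPair params (a ++ [b]) ∈ LF
  · rw [iteFn_apply_true (by rw [hc, Set.mem_iff_boolIndicator _ _ |>.1 h]), if_pos h]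
    simp [childF]
  · rw [iteFn_apply_false (by rw [hc, Set.notMem_iff_boolIndicator _ _ |>.1 h]), if_neg h]
    simp

/-- Value of the step on a step record. [folklore] -/
theorem stepF_apply (hind : ∀ v, indF v = [LF.boolIndicator v]) (params FR a acc : List Bool) :
    stepF indF (boolPair (boolPair params FR) (boolPair a acc)) = trySem LF params a true (trySem LF params a false acc) := by
  rw [stepF, Function.comp_apply]
  simp only [fanoutFn_apply, fstF_boolPair, nthF_succ_boolPair, nthF_zero_boolPair]
  rw [tryF_apply hind, tryF_apply hind]

/-- **The left fold of the step codes the level**: from `enc acc₀`, folding over the items `l` yields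
`enc (level l ++ acc₀)` (the accepted children, latest first). [folklore] -/
theorem foldl_step (params : List Bool) : ∀ (l acc₀ : List (List Bool)),
    l.foldl (fun acc a => trySem LF params a true (trySem LF params a false acc)) (encList acc₀) =
      encList (level LF params l ++ acc₀)
  | [], acc₀ => by simp [level, children]
  | a :: l, acc₀ => by
    classical
    rw [List.foldl_cons]
    have hch : children (a :: l) = [a ++ [false], a ++ [true]] ++ children l := by simp [children]
    have h2 : trySem LF params a true (trySem LF params a false (encList acc₀)) =
        encList ((([a ++ [false], a ++ [true]] : List (List Bool)).filter fun c => boolPair params c ∈ LF).reverse ++ acc₀) := by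
      by_cases h0 : boolPair params (a ++ [false]) ∈ LF <;> by_cases h1 : boolPair params (a ++ [true]) ∈ LF <;>
        simp [trySem, h0, h1, encList]
    rw [h2, foldl_step params l]
    simp only [level, hch, List.filter_append, List.reverse_append, List.append_assoc]

/-- **Value of the level fold on `⟨params, FRONT⟩`.** [folklore] -/
theorem foldFn_step_apply (hind : ∀ v, indF v = [LF.boolIndicator v]) (params FR : List Bool) :
    foldFn (stepF indF) (fun _ => []) (boolPair params FR) = encList (level LF params (decNil FR)) := by
  rw [foldFn_boolPair]
  have h := foldl_step (LF := LF) params (decNil FR) []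
  rw [List.append_nil, encList] at h
  rw [← h]
  exact congrArg (fun f => List.foldl f [] (decNil FR)) (funext fun acc => funext fun a => stepF_apply hind params FR a acc)

/-- Value of the clip length. [folklore] -/
theorem boundU_apply (params : List Bool) :
    boundU nF mF params = ones (3 * (mF params).length * (2 * (nF params).length + 2)) := by
  simp only [boundU, m1, n1, Function.comp_apply, fanoutFn_apply, concatFn_boolPair, onesFn, unaryEncodeNat_eq_replicate]
  have h3 : List.replicate (mF params).length true ++ (List.replicate (mF params).length true ++ List.replicate (mF params).length true) =
      ones (3 * (mF params).length) := by
    simp only [ones, List.replicate_append_replicate]; congr 1; ring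
  have h2 : true :: true :: (List.replicate (nF params).length true ++ List.replicate (nF params).length true) =
      ones (2 * (nF params).length + 2) := by
    simp only [ones, List.replicate_append_replicate]
    rw [show 2 * (nF params).length + 2 = ((nF params).length + (nF params).length) + 1 + 1 by ring,
      List.replicate_succ, List.replicate_succ]
  rw [h3, h2, umulFn_boolPair]

/-- **Value of one level on `⟨params, FRONT⟩`.** [folklore] -/
theorem levelF_apply (hind : ∀ v, indF v = [LF.boolIndicator v]) (params FR : List Bool) :
    levelF indF nF mF (boolPair params FR) =
      (encList (level LF params (decNil FR))).take (3 * (mF params).length * (2 * (nF params).length + 2)) := by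
  simp only [levelF, Function.comp_apply, fanoutFn_apply, fstF_boolPair, boundU_apply, foldFn_step_apply hind, takeFn_boolPair,
    ones, List.length_replicate]

/-- **The rounds on `⟨1ⁿ, ⟨params, FRONT⟩⟩`.** [folklore] -/
theorem iterate_roundF (hind : ∀ v, indF v = [LF.boolIndicator v]) (un params : List Bool) :
    ∀ (r : ℕ) (FR : List Bool), (roundF indF nF mF)^[r] (boolPair un (boolPair params FR)) =
      boolPair un (boolPair params ((fun F => (encList (level LF params (decNil F))).take
        (3 * (mF params).length * (2 * (nF params).length + 2)))^[r] FR))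
  | 0, FR => rfl
  | r + 1, FR => by
    rw [Function.iterate_succ_apply, Function.iterate_succ_apply]
    have h1 : roundF indF nF mF (boolPair un (boolPair params FR)) =
        boolPair un (boolPair params ((encList (level LF params (decNil FR))).take
          (3 * (mF params).length * (2 * (nF params).length + 2)))) := by
      simp only [roundF, fanoutFn_apply, fstF_boolPair, Function.comp_apply, sndF_boolPair, levelF_apply hind]
    rw [h1, iterate_roundF hind un params r]

/-- The length of a coded list of short items (a local copy of the bound of
`DinurSafraFP.length_encList_le_of_bound`, not imported to keep this toolkit light). [folklore] -/
private theorem length_encList_le {l : List (List Bool)} {n : ℕ} (h : ∀ a ∈ l, a.length ≤ n) : (encList l).length ≤ l.length * (2 * n + 2) := by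
  induction l with
  | nil => simp [encList]
  | cons a l ih =>
    have ha := h a (by simp)
    have := ih fun b hb => h b (by simp [hb])
    simp only [encList, length_boolPair, List.length_cons, Nat.succ_mul]
    nlinarith

/-- **Value of the enumerator on a heavy string's parameters**: if every frontier up to level `n` has
fewer than `3M` items of the level's length, the clips are inactive and the enumerator returns a code of
`ε :: frontier n`. [folklore] -/
theorem decNil_enumF (hind : ∀ v, indF v = [LF.boolIndicator v]) (params : List Bool) {n : ℕ} (hn : (nF params).length = n)
    (hfront : ∀ ℓ, ℓ ≤ n → (∀ u ∈ frontier LF params ℓ, u.length = ℓ) ∧ (frontier LF params ℓ).length < 3 * (mF params).length) :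
    decNil (enumF indF nF mF params) = [] :: frontier LF params n := by
  have hinit : initF nF params = boolPair (ones n) (boolPair params (encList [[]])) := by
    simp [initF, n1, onesFn, unaryEncodeNat_eq_replicate, ones, hn]
  -- the clips are inactive along the true frontiers
  have hiter : ∀ r, r ≤ n → (fun F => (encList (level LF params (decNil F))).take
      (3 * (mF params).length * (2 * (nF params).length + 2)))^[r] (encList [[]]) = encList (frontier LF params r) := by
    intro r
    induction r with
    | zero => intro _; rfl
    | succ r ih =>
      intro hr
      rw [Function.iterate_succ_apply', ih (by omega), decNil_encList, List.take_of_length_le]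
      · rfl
      · obtain ⟨hlen, hcard⟩ := hfront (r + 1) hr
        change (encList (frontier LF params (r + 1))).length ≤ _
        refine (length_encList_le (n := n) fun a ha => by rw [hlen a ha]; omega).trans ?_
        rw [hn]
        exact Nat.mul_le_mul_right _ (by omega)
  rw [enumF, fanoutFn_apply, decNil_boolPair, Function.comp_apply, Function.comp_apply, hinit, iterF, boolUnpair_boolPair]
  simp only [ones, List.length_replicate, eval_X]
  rw [← ones, iterate_roundF hind, hiter n le_rfl, sndPow_succ_boolPair, sndPow_zero_boolPair, decNil_encList]

/-- Growth of `tryF` on every input. [folklore] -/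
theorem length_tryF_le (hind : ∀ v, indF v = [LF.boolIndicator v]) (b : Bool) (v : List Bool) :
    (tryF indF b v).length ≤ (sndPow 1 v).length + 2 * (nthF 1 v).length + 4 := by
  have h1 : OneBit (indF ∘ fanoutFn prm2 (childF b)) := fun w => ⟨_, hind _⟩
  rw [tryF, iteFn_of_oneBit h1]
  split_ifs
  · rw [length_fanoutFn]
    simp [childF]
    omega
  · omega

/-- **The step has fold growth `8`.** [folklore] -/
theorem foldGrowth_stepF (hind : ∀ v, indF v = [LF.boolIndicator v]) : FoldGrowth 8 (stepF indF) := by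
  intro v
  have h1 := length_tryF_le hind true (boolPair (fstF v) (boolPair (nthF 1 v) (tryF indF false v)))
  have h2 := length_tryF_le hind false v
  simp only [sndPow_succ_boolPair, sndPow_zero_boolPair, nthF_succ_boolPair, nthF_zero_boolPair] at h1
  rw [stepF, Function.comp_apply]
  simp only [fanoutFn_apply]
  change _ ≤ (sndPow 1 v).length + 4 * (nthF 1 v).length + 8 * ((fstF v).length + 1)
  omega

/-- `stepF ∈ FP`. [folklore] -/
theorem stepF_mem_FP (hindF : indF ∈ FP) : stepF indF ∈ FP := by
  have hprm : prm2 ∈ FP := comp_mem_FP fstF_mem_FP fstF_mem_FP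
  have hchild : ∀ b, childF b ∈ FP := fun b => comp_mem_FP concatFn_mem_FP (fanoutFn_mem_FP (nthF_mem_FP 1) (const_mem_FP _))
  have htry : ∀ b, tryF indF b ∈ FP := fun b =>
    iteFn_mem_FP (comp_mem_FP hindF (fanoutFn_mem_FP hprm (hchild b))) (fanoutFn_mem_FP (hchild b) (sndPow_mem_FP 1)) (sndPow_mem_FP 1)
  exact comp_mem_FP (htry true) (fanoutFn_mem_FP fstF_mem_FP (fanoutFn_mem_FP (nthF_mem_FP 1) (htry false)))

/-- `boundU ∈ FP`. [folklore] -/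
theorem boundU_mem_FP (hn : nF ∈ FP) (hm : mF ∈ FP) : boundU nF mF ∈ FP := by
  have h1 : m1 mF ∈ FP := comp_mem_FP onesFn_mem_FP hm
  have h2 : n1 nF ∈ FP := comp_mem_FP onesFn_mem_FP hn
  exact comp_mem_FP umulFn_mem_FP (fanoutFn_mem_FP
    (comp_mem_FP concatFn_mem_FP (fanoutFn_mem_FP h1 (comp_mem_FP concatFn_mem_FP (fanoutFn_mem_FP h1 h1))))
    (comp_mem_FP (cons_mem_FP true) (comp_mem_FP (cons_mem_FP true) (comp_mem_FP concatFn_mem_FP (fanoutFn_mem_FP h2 h2)))))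

/-- `levelF ∈ FP`. [folklore] -/
theorem levelF_mem_FP (hind : ∀ v, indF v = [LF.boolIndicator v]) (hindF : indF ∈ FP) (hn : nF ∈ FP) (hm : mF ∈ FP) :
    levelF indF nF mF ∈ FP :=
  comp_mem_FP takeFn_mem_FP (fanoutFn_mem_FP (comp_mem_FP (boundU_mem_FP hn hm) fstF_mem_FP)
    (foldFn_mem_FP (stepF_mem_FP hindF) (const_mem_FP _) (foldGrowth_stepF hind)))

/-- The level's output is clipped. [folklore] -/
theorem length_levelF_le (z : List Bool) : (levelF indF nF mF z).length ≤ (boundU nF mF (fstF z)).length := by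
  simp only [levelF, Function.comp_apply, fanoutFn_apply, takeFn_boolPair]
  exact List.length_take_le _ _

/-- **The rounds keep their first two fields and stay polynomially short.** [folklore] -/
theorem iterate_roundF_shape (z : List Bool) : ∀ r : ℕ, ∃ lev : List Bool,
    (roundF indF nF mF)^[r + 1] z = boolPair (fstF z) (boolPair (fstF (sndF z)) lev) ∧ lev.length ≤ (boundU nF mF (fstF (sndF z))).length
  | 0 => ⟨levelF indF nF mF (sndF z), by simp [roundF], length_levelF_le _⟩
  | r + 1 => by
    obtain ⟨lev, hr, -⟩ := iterate_roundF_shape z r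
    refine ⟨levelF indF nF mF (boolPair (fstF (sndF z)) lev), ?_, ?_⟩
    · rw [Function.iterate_succ_apply', hr]
      simp [roundF]
    · exact (length_levelF_le _).trans (by rw [fstF_boolPair])

/-- `iterF ∈ FP`. [folklore] -/
theorem iterF_mem_FP (hind : ∀ v, indF v = [LF.boolIndicator v]) (hindF : indF ∈ FP) (hn : nF ∈ FP) (hm : mF ∈ FP) :
    iterF indF nF mF ∈ FP := by
  obtain ⟨sb, hsb⟩ := exists_poly_length_le_of_mem_FP (boundU_mem_FP (nF := nF) (mF := mF) hn hm)
  have hround : roundF indF nF mF ∈ FP :=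
    fanoutFn_mem_FP fstF_mem_FP (fanoutFn_mem_FP (comp_mem_FP fstF_mem_FP sndF_mem_FP)
      (comp_mem_FP (levelF_mem_FP hind hindF hn hm) sndF_mem_FP))
  refine iterate_mem_FP_of_poly hround (4 * X + 4 + sb) (fun z r => ?_) X
  have hz0 := length_fstF_sndF_le z
  have hz1 := length_fstF_sndF_le (sndF z)
  have hmono : sb.eval (fstF (sndF z)).length ≤ sb.eval (z.length + r) := TM2Iter.eval_mono sb (by omega)
  simp only [eval_add, eval_mul, eval_ofNat, eval_X]
  rcases r with _ | r
  · simp only [Function.iterate_zero, id_eq]; omega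
  · obtain ⟨lev, hr, hlev⟩ := iterate_roundF_shape (indF := indF) (nF := nF) (mF := mF) z r
    rw [hr, length_boolPair, length_boolPair]
    have := hsb (fstF (sndF z))
    omega

/-- **`enumF ∈ FP`.** [folklore] -/
theorem enumF_mem_FP (hind : ∀ v, indF v = [LF.boolIndicator v]) (hindF : indF ∈ FP) (hn : nF ∈ FP) (hm : mF ∈ FP) :
    enumF indF nF mF ∈ FP :=
  fanoutFn_mem_FP (const_mem_FP _) (comp_mem_FP (sndPow_mem_FP 1) (comp_mem_FP (iterF_mem_FP hind hindF hn hm)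
    (fanoutFn_mem_FP (comp_mem_FP onesFn_mem_FP hn) (fanoutFn_mem_FP (PolyTimeComputable.id _) (const_mem_FP _)))))

end EnumMachine

/-! ### Main theorem -/

/-- **Enumerating the heavy outputs of a randomised polynomial-time function, under `PromiseBPP' ⊆ PromiseP`.**
Let `R ∈ FP` be run as `R ⟨params, coins⟩` with `C = |cF params|` coins, and let `M = |mF params|`,
`n = |nF params|` (`cF, mF, nF ∈ FP`). If `PromiseBPP' ⊆ PromiseP` then there is `E ∈ FP` such that for
all `params` and every `x ∈ {0,1}ⁿ` that one run outputs with probability `≥ 2/M`, the list coded by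
`E params` contains `x`. Proof: the `M`-run test "some run outputs an extension of `u`" puts the promise
problem (`Pr ≥ 2/3` / `Pr ≤ 1/3`) in `PromiseBPP'` (`prefixProblem_mem_PromiseBPP'`), hence in `PromiseP`;
its separator drives a prefix search of `n` levels whose frontiers keep every prefix of `x` and stay below
`3M` strings (`frontier_spec`), computed in polynomial time (`enumF_mem_FP`, `decNil_enumF`).
[Goldreich 2006, §1.2 (promise-BPP, `pr-BPP = pr-P` as a derandomisation hypothesis); Arora–Barak 2009,
§7.4.1; the prefix search is folklore (cf. Goldreich 2008, §6.2.4, search-to-decision for candid promise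
problems)] [folklore] -/
theorem exists_enum_of_PromiseBPP'_subset (hBPP : PromiseBPP' ⊆ PromiseP) {R cF mF nF : List Bool → List Bool}
    (hR : R ∈ FP) (hc : cF ∈ FP) (hm : mF ∈ FP) (hn : nF ∈ FP) :
    ∃ E : List Bool → List Bool, E ∈ FP ∧ ∀ params x : List Bool, x.length = (nF params).length →
      2 ≤ (mF params).length * uniformProb (cF params).length {c | R (boolPair params c) = x} → x ∈ decNil (E params) := by
  obtain ⟨LF, hLF, hyes, hno⟩ := hBPP (prefixProblem_mem_PromiseBPP' hR hc hm)
  set indF : List Bool → List Bool := fun v => encodeBool (LF.boolIndicator v) with hindF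
  have hind : ∀ v, indF v = [LF.boolIndicator v] := fun v => by
    simp only [hindF]; cases LF.boolIndicator v <;> rfl
  have hindFP : indF ∈ FP := indicatorFn_mem_FP hLF
  refine ⟨enumF indF nF mF, enumF_mem_FP hind hindFP hn hm, fun params x hx hheavy => ?_⟩
  obtain ⟨hy, hn'⟩ := separator_spec hyes hno params
  have hspec := frontier_spec (LF := LF) hy hn' hheavy
  rw [decNil_enumF hind params rfl fun ℓ hℓ => ⟨(hspec ℓ (by omega)).2.2.1, (hspec ℓ (by omega)).2.2.2⟩]
  refine List.mem_cons_of_mem _ ?_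
  have h := (hspec x.length le_rfl).1
  rwa [List.take_length, hx] at h

end HeavyEnum

end Literature.Computability.Complexity

end
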